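import Summits.ResolutionOfSingularities.ResolutionOfSingularities.Theorems.FrobeniusClosingSteerCore4IsoIsolCompletion
import Literature.RingTheory.MvPowerSeries.MaximalIdealPow
import Literature.AlgebraicGeometry.Resolution.QuasiRegularSequences
import Literature.AlgebraicGeometry.Resolution.PlaneChartEndomorphism
import Mathlib.RingTheory.AdicCompletion.LocalRing
import HarnessLib

/-!
# Crux `Steer` (stmt-ResolutionOfSingularities-16345), chain W4.1, hG3 / G-geom WORK-DIRECT: Lemma F♭ PART 3b(C) — COMPLETION RECOGNITION
# (a ring hom `S → K⟦X₁,…,Xₙ⟧` sending a generating family of `𝔪_S` to the variables and surjective on residue classes identifies `Ŝ` with `K⟦X⟧`)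

OURS (campaign `res-hironaka`, rung L ★L-G4, slot W4.1; seat res-L0-w41-stub-2 g6, res-L0-w41-plan-1 RULINGs 136a/152a/152c; replaces the role of no
printed item; NOT a statement of the manuscript under review [claim: Hironaka2017, status: under-review]; AI-produced, weaker than expert review).
Theses-free, definition-free; any field `K` (no perfectness, no characteristic hypothesis), any Noetherian local `S` (no regularity: injectivity comes
from the TARGET being a power series ring, not from quasi-regularity of the source).

Setting: `S` Noetherian local, `ψ : S →+* K⟦X₁,…,Xₙ⟧` with `𝔪_S = (g₁,…,gₙ)`, `ψ gᵢ = Xᵢ`.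
* `CompletionRecognition.map_maximalIdeal_eq` — `𝔪_S · K⟦X⟧ = 𝔪_{K⟦X⟧}`;
* `CompletionRecognition.mem_pow_of_map_mem_pow` — **CONTRACTION** `ψ s ∈ 𝔪^N ⇒ s ∈ 𝔪_S^N` (write `s ∈ 𝔪_S^k ∖ 𝔪_S^{k+1}` as a `k`-form in the `gᵢ` with a
  unit coefficient; its image has a non-zero coefficient in degree `k`);
* `CompletionRecognition.exists_sub_map_mem_pow` — **DENSITY** `∀ t N, ∃ s, t − ψ s ∈ 𝔪^N`, given residue surjectivity `∀ c, ∃ s, (ψ s)(0) = c`;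
* `CompletionRecognition.exists_ringEquiv` — **RECOGNITION**: then the adic extension `ψ̂ : Ŝ → K⟦X⟧` (res-L0-w41-stub-2 p478623
  `Isol.exists_ringHom_adicCompletion_extend`) is a ring ISOMORPHISM `Ŝ ≃+* K⟦X⟧` with `ψ̂ ∘ (S → Ŝ) = ψ`.
Consumer: PART 3b(D) (the frame of `Ŝ₀` induced by the stage-`M` Cohen frame along a rational free chain), and res-D-pv-007's Lemma S stage (T).
[cite: Matsumura1987, Thm. 8.12 and §29 (proof of Thm. 29.4)] [folklore]
-/

noncomputable section

set_option linter.dupNamespace false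

open IsLocalRing MvPowerSeries
open Literature.RingTheory.MvPowerSeries Literature.AlgebraicGeometry.Resolution

namespace Summit.ResolutionOfSingularities.ResolutionOfSingularities.Theorems.SwitchingDichotomy.CompletionRecognition

universe u v

variable {S : Type u} [CommRing S] [IsLocalRing S] {K : Type v} [Field K] {n : ℕ}
  (ψ : S →+* MvPowerSeries (Fin n) K) (g : Fin n → S)
  (hg : Ideal.span (Set.range g) = maximalIdeal S) (hψ : ∀ i, ψ (g i) = X i)

/-! ## The extended maximal ideal and monomials -/

include hg hψ in
/-- `ψ(𝔪_S) · K⟦X⟧ = (X₁, …, Xₙ) = 𝔪_{K⟦X⟧}`. [folklore] -/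
theorem map_maximalIdeal_eq : (maximalIdeal S).map ψ = maximalIdeal (MvPowerSeries (Fin n) K) := by
  rw [← hg, Ideal.map_span, maximalIdeal_mvPowerSeries_eq_span K (Fin n), ← Set.range_comp]
  congr 1
  ext f
  constructor
  · rintro ⟨i, rfl⟩; exact ⟨i, (hψ i).symm⟩
  · rintro ⟨i, rfl⟩; exact ⟨i, hψ i⟩

include hg hψ in
/-- `ψ` maps `𝔪_S^N` into `𝔪^N`. [folklore] -/
theorem map_mem_pow {N : ℕ} {s : S} (hs : s ∈ maximalIdeal S ^ N) : ψ s ∈ maximalIdeal (MvPowerSeries (Fin n) K) ^ N := by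
  rw [← map_maximalIdeal_eq ψ g hg hψ, ← Ideal.map_pow]
  exact Ideal.mem_map_of_mem ψ hs

omit [IsLocalRing S] in
/-- The monomial `X^e` as a product of powers of the variables. [folklore] -/
theorem prod_X_pow_eq_monomial (e : Fin n →₀ ℕ) :
    (∏ i, (X i : MvPowerSeries (Fin n) K) ^ e i) = monomial e (1 : K) := by
  classical
  have h1 : (∏ i, (MvPolynomial.X i : MvPolynomial (Fin n) K) ^ e i) = MvPolynomial.monomial e 1 := by
    rw [MvPolynomial.monomial_eq, MvPolynomial.C_1, one_mul, Finsupp.prod_fintype]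
    intro i; rw [pow_zero]
  have h2 : ((∏ i, (MvPolynomial.X i : MvPolynomial (Fin n) K) ^ e i : MvPolynomial (Fin n) K) : MvPowerSeries (Fin n) K) =
      ∏ i, (X i : MvPowerSeries (Fin n) K) ^ e i := by
    rw [← MvPolynomial.coeToMvPowerSeries.ringHom_apply, map_prod]
    simp [MvPolynomial.coe_X]
  rw [← h2, h1, MvPolynomial.coe_monomial]

include hψ in
omit [IsLocalRing S] in
/-- `ψ (∏ gᵢ^{eᵢ}) = X^e`. [folklore] -/
theorem map_prod_pow (e : Fin n →₀ ℕ) : ψ (∏ i, g i ^ e i) = monomial e (1 : K) := by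
  rw [map_prod]
  simp_rw [map_pow, hψ]
  exact prod_X_pow_eq_monomial e

/-! ## Contraction: `ψ s ∈ 𝔪^N ⇒ s ∈ 𝔪_S^N` -/

include hψ in
omit [IsLocalRing S] in
/-- The coefficient of `X^{e₀}` in `ψ (F(g))` for a `k`-form `F` with coefficients in `S` and `|e₀| = k` is the constant term of `ψ (coeff e₀ F)`:
only the monomial `e₀` of `F` contributes in degree `|e₀|`. [folklore] -/
theorem coeff_map_eval_of_isHomogeneous {k : ℕ} {F : MvPolynomial (Fin n) S} (hF : F.IsHomogeneous k)
    {e₀ : Fin n →₀ ℕ} (he₀ : e₀.degree = k) :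
    coeff e₀ (ψ (MvPolynomial.eval g F)) = constantCoeff (ψ (F.coeff e₀)) := by
  classical
  have hev : ψ (MvPolynomial.eval g F) = ∑ d ∈ F.support, ψ (F.coeff d) * monomial d (1 : K) := by
    change ψ (MvPolynomial.eval₂ (RingHom.id S) g F) = _
    rw [MvPolynomial.eval₂_comp_left, MvPolynomial.eval₂_eq]
    refine Finset.sum_congr rfl fun d _ => ?_
    congr 1
    rw [← map_prod_pow ψ g hψ d, map_prod]
    simp_rw [map_pow, Function.comp_apply]
    rw [Finset.prod_subset (Finset.subset_univ d.support)]
    intro i _ hi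
    rw [Finsupp.notMem_support_iff.mp hi, pow_zero]
  rw [hev, map_sum]
  have hterm : ∀ d ∈ F.support, coeff e₀ (ψ (F.coeff d) * monomial d (1 : K)) =
      if d = e₀ then constantCoeff (ψ (F.coeff e₀)) else 0 := by
    intro d hd
    rw [coeff_mul_monomial, mul_one]
    by_cases hde : d = e₀
    · subst hde; rw [if_pos le_rfl, if_pos rfl, tsub_self, coeff_zero_eq_constantCoeff]
    · rw [if_neg hde]
      by_cases hle : d ≤ e₀
      · exfalso; apply hde
        have hdd : d.degree = k := by
          rw [Finsupp.degree_eq_weight_one]; exact hF (MvPolynomial.mem_support_iff.mp hd)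
        exact PlaneChart.eq_of_le_of_degree_eq hle (hdd.trans he₀.symm)
      · rw [if_neg hle]
  rw [Finset.sum_congr rfl hterm, Finset.sum_ite_eq' F.support e₀]
  split_ifs with hmem
  · rfl
  · rw [MvPolynomial.notMem_support_iff.mp hmem, map_zero, map_zero]

include hg hψ in
/-- **Contraction.** If `ψ s ∈ 𝔪^N` then `s ∈ 𝔪_S^N`: otherwise `s ∈ 𝔪_S^k ∖ 𝔪_S^{k+1}` for some `k < N`, `s = F(g)` for a `k`-form `F` with some
coefficient `c_{e₀}` a unit of `S`, and then `X^{e₀}` has coefficient `(ψ c_{e₀})(0) ≠ 0` in `ψ s`, impossible in `𝔪^N`. [folklore] -/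
theorem mem_pow_of_map_mem_pow {N : ℕ} {s : S} (hs : ψ s ∈ maximalIdeal (MvPowerSeries (Fin n) K) ^ N) :
    s ∈ maximalIdeal S ^ N := by
  classical
  by_contra hsN
  -- the least `k₀` with `s ∉ 𝔪^{k₀}`; `k₀ = k + 1`, `s ∈ 𝔪^k ∖ 𝔪^{k+1}`, `k + 1 ≤ N`
  have hex : ∃ k, s ∉ maximalIdeal S ^ k := ⟨N, hsN⟩
  set k₀ := Nat.find hex with hk₀
  have hk₀spec : s ∉ maximalIdeal S ^ k₀ := Nat.find_spec hex
  have hk₀pos : k₀ ≠ 0 := by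
    intro h; rw [h, pow_zero, Ideal.one_eq_top] at hk₀spec; exact hk₀spec Submodule.mem_top
  obtain ⟨k, hk⟩ : ∃ k, k₀ = k + 1 := Nat.exists_eq_succ_of_ne_zero hk₀pos
  have hsk : s ∈ maximalIdeal S ^ k := by
    by_contra h; have := Nat.find_min hex (show k < k₀ by omega); exact this h
  have hsk1 : s ∉ maximalIdeal S ^ (k + 1) := hk ▸ hk₀spec
  have hkN : k + 1 ≤ N := by
    have : k₀ ≤ N := Nat.find_min' hex hsN
    omega
  -- `s = F(g)`, `F` a `k`-form
  rw [← hg] at hsk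
  obtain ⟨F, hF, hFs⟩ := exists_isHomogeneous_of_mem_span_pow g k hsk
  -- some coefficient of `F` is a unit
  have hcoef : ∃ e₀, F.coeff e₀ ∉ maximalIdeal S := by
    by_contra hall
    push Not at hall
    apply hsk1
    have hFC : F ∈ Ideal.map MvPolynomial.C (maximalIdeal S) := by
      rw [MvPolynomial.mem_map_C_iff]; exact hall
    have h := eval_mem_mul_span_pow g hF hFC
    rw [hg, ← pow_succ', hFs] at h
    exact h
  obtain ⟨e₀, he₀⟩ := hcoef
  have he₀ne : F.coeff e₀ ≠ 0 := fun h => he₀ (h ▸ zero_mem _)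
  have he₀deg : e₀.degree = k := by
    rw [Finsupp.degree_eq_weight_one]; exact hF he₀ne
  -- the coefficient of `X^{e₀}` in `ψ s` is a unit, but `ψ s ∈ 𝔪^N` with `|e₀| < N`
  have hunit : IsUnit (constantCoeff (ψ (F.coeff e₀))) := by
    have hu : IsUnit (F.coeff e₀) := by
      by_contra h; exact he₀ ((IsLocalRing.mem_maximalIdeal _).mpr h)
    exact isUnit_constantCoeff _ (hu.map ψ)
  have hzero : coeff e₀ (ψ s) = 0 :=
    Jets.coeff_eq_zero_of_mem_maximalIdeal_pow hs (by rw [he₀deg]; omega)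
  rw [← hFs, coeff_map_eval_of_isHomogeneous ψ g hψ hF he₀deg] at hzero
  exact hunit.ne_zero hzero

/-! ## Density: `∀ t N, ∃ s, t − ψ s ∈ 𝔪^N` -/

include hψ in
omit [IsLocalRing S] in
/-- **Density.** If every element of `K` is the constant term of some `ψ s`, then every `t ∈ K⟦X⟧` is approximated by images: `t − ψ s ∈ 𝔪^N`.
(Induction on `N`: the degree-`N` part `Σ_{|e|=N} X^e · q_e` of the error is `ψ(Σ_e g^e s_e)` modulo `𝔪^{N+1}` once `q_e ≡ ψ s_e (mod 𝔪)`.)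
[folklore] -/
theorem exists_sub_map_mem_pow (hres : ∀ c : K, ∃ s : S, constantCoeff (ψ s) = c) (N : ℕ) (t : MvPowerSeries (Fin n) K) :
    ∃ s : S, t - ψ s ∈ maximalIdeal (MvPowerSeries (Fin n) K) ^ N := by
  classical
  induction N generalizing t with
  | zero => exact ⟨0, by rw [pow_zero, Ideal.one_eq_top]; exact Submodule.mem_top⟩
  | succ N ih =>
    obtain ⟨s, hs⟩ := ih t
    set r := t - ψ s with hr
    obtain ⟨T, q, hT, hrq⟩ := Jets.exists_eq_sum_monomial_mul N r fun e he => Jets.coeff_eq_zero_of_mem_maximalIdeal_pow hs he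
    -- lifts of the constant terms of the `q e`
    have hlift : ∀ e, ∃ s' : S, q e - ψ s' ∈ maximalIdeal (MvPowerSeries (Fin n) K) := by
      intro e
      obtain ⟨s', hs'⟩ := hres (constantCoeff (q e))
      exact ⟨s', by rw [Jets.mem_maximalIdeal_iff_constantCoeff_eq_zero, map_sub, hs', sub_self]⟩
    choose σ hσ using hlift
    refine ⟨s + ∑ e ∈ T, (∏ i, g i ^ e i) * σ e, ?_⟩
    have hdecomp : t - ψ (s + ∑ e ∈ T, (∏ i, g i ^ e i) * σ e) = ∑ e ∈ T, monomial e (1 : K) * (q e - ψ (σ e)) := by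
      rw [map_add, ← sub_sub, ← hr, hrq, map_sum, ← Finset.sum_sub_distrib]
      refine Finset.sum_congr rfl fun e _ => ?_
      rw [map_mul, map_prod_pow ψ g hψ e, mul_sub]
    rw [hdecomp]
    refine Ideal.sum_mem _ fun e he => ?_
    rw [pow_succ]
    exact Ideal.mul_mem_mul (Jets.monomial_mem_maximalIdeal_pow (hT e he).ge 1) (hσ e)

/-! ## The completion `Ŝ`: density of `S`, and the extension `ψ̂` -/

section Completion

variable [IsNoetherianRing S]

omit [IsLocalRing S] in
/-- An element of `Ŝ` whose `N`-th component vanishes lies in `𝔪̂^N`. [folklore] -/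
theorem mem_maximalIdeal_pow_of_val_eq_zero [IsLocalRing S] {N : ℕ} {y : AdicCompletion (maximalIdeal S) S} (hy : y.val N = 0) :
    y ∈ maximalIdeal (AdicCompletion (maximalIdeal S) S) ^ N := by
  have h1 : y ∈ ((maximalIdeal S) ^ N • ⊤ : Submodule S (AdicCompletion (maximalIdeal S) S)) := by
    rw [AdicCompletion.pow_smul_top_eq_ker_eval ((maximalIdeal S).fg_of_isNoetherianRing), LinearMap.mem_ker,
      AdicCompletion.eval_apply, hy]
  rw [Ideal.smul_top_eq_map, Submodule.restrictScalars_mem, Ideal.map_pow] at h1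
  rwa [AdicCompletion.maximalIdeal_eq_map]

/-- **Density of `S` in `Ŝ`**: every element of `Ŝ` is congruent modulo `𝔪̂^N` to the image of an element of `S`. [folklore] -/
theorem exists_sub_algebraMap_mem_pow (x : AdicCompletion (maximalIdeal S) S) (N : ℕ) :
    ∃ s : S, x - algebraMap S (AdicCompletion (maximalIdeal S) S) s ∈ maximalIdeal (AdicCompletion (maximalIdeal S) S) ^ N := by
  obtain ⟨s, hs⟩ := Submodule.Quotient.mk_surjective _ (x.val N)
  refine ⟨s, mem_maximalIdeal_pow_of_val_eq_zero ?_⟩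
  rw [AdicCompletion.val_sub_apply, AdicCompletion.algebraMap_apply, Algebra.algebraMap_self_apply, AdicCompletion.of_apply,
    Submodule.mkQ_apply, hs, sub_self]

variable {ψ}

include hg hψ in
/-- The extension `ψ̂` maps `𝔪̂^N` into `𝔪^N`. [folklore] -/
theorem extend_map_mem_pow {φ : AdicCompletion (maximalIdeal S) S →+* MvPowerSeries (Fin n) K}
    (hφ : ∀ s : S, φ (algebraMap S (AdicCompletion (maximalIdeal S) S) s) = ψ s) {N : ℕ}
    {y : AdicCompletion (maximalIdeal S) S} (hy : y ∈ maximalIdeal (AdicCompletion (maximalIdeal S) S) ^ N) :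
    φ y ∈ maximalIdeal (MvPowerSeries (Fin n) K) ^ N := by
  have hcomp : φ.comp (algebraMap S (AdicCompletion (maximalIdeal S) S)) = ψ := RingHom.ext hφ
  have hmap : (maximalIdeal (AdicCompletion (maximalIdeal S) S)).map φ = maximalIdeal (MvPowerSeries (Fin n) K) := by
    rw [AdicCompletion.maximalIdeal_eq_map, Ideal.map_map, hcomp, map_maximalIdeal_eq ψ g hg hψ]
  rw [← hmap, ← Ideal.map_pow]
  exact Ideal.mem_map_of_mem φ hy

include hg hψ in
/-- `ψ̂ x ≡ ψ s (mod 𝔪^N)` whenever `x ≡ s (mod 𝔪̂^N)`. [folklore] -/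
theorem extend_sub_mem_pow {φ : AdicCompletion (maximalIdeal S) S →+* MvPowerSeries (Fin n) K}
    (hφ : ∀ s : S, φ (algebraMap S (AdicCompletion (maximalIdeal S) S) s) = ψ s) {N : ℕ}
    {x : AdicCompletion (maximalIdeal S) S} {s : S}
    (hxs : x - algebraMap S (AdicCompletion (maximalIdeal S) S) s ∈ maximalIdeal (AdicCompletion (maximalIdeal S) S) ^ N) :
    φ x - ψ s ∈ maximalIdeal (MvPowerSeries (Fin n) K) ^ N := by
  have := extend_map_mem_pow g hg hψ hφ hxs
  rwa [map_sub, hφ] at this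

include hg hψ in
/-- **Injectivity of the extension.** [folklore] -/
theorem extend_injective {φ : AdicCompletion (maximalIdeal S) S →+* MvPowerSeries (Fin n) K}
    (hφ : ∀ s : S, φ (algebraMap S (AdicCompletion (maximalIdeal S) S) s) = ψ s) : Function.Injective φ := by
  rw [injective_iff_map_eq_zero]
  intro x hx
  refine eq_zero_of_forall_mem_pow (maximalIdeal (AdicCompletion (maximalIdeal S) S)) fun N => ?_
  obtain ⟨s, hs⟩ := exists_sub_algebraMap_mem_pow x N
  have h1 : φ x - ψ s ∈ maximalIdeal (MvPowerSeries (Fin n) K) ^ N := extend_sub_mem_pow g hg hψ hφ hs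
  rw [hx, zero_sub, neg_mem_iff] at h1
  have h2 : s ∈ maximalIdeal S ^ N := mem_pow_of_map_mem_pow ψ g hg hψ h1
  have h3 : algebraMap S (AdicCompletion (maximalIdeal S) S) s ∈ maximalIdeal (AdicCompletion (maximalIdeal S) S) ^ N := by
    rw [AdicCompletion.maximalIdeal_eq_map, ← Ideal.map_pow]
    exact Ideal.mem_map_of_mem _ h2
  have := Ideal.add_mem _ hs h3
  rwa [sub_add_cancel] at this

include hg hψ in
/-- **Surjectivity of the extension** (given residue surjectivity): approximate `t` by `ψ s_N` modulo `𝔪^N`; by contraction `(s_N)` is `𝔪_S`-adically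
Cauchy, and its class in `Ŝ` maps to `t`. [folklore] -/
theorem extend_surjective (hres : ∀ c : K, ∃ s : S, constantCoeff (ψ s) = c)
    {φ : AdicCompletion (maximalIdeal S) S →+* MvPowerSeries (Fin n) K}
    (hφ : ∀ s : S, φ (algebraMap S (AdicCompletion (maximalIdeal S) S) s) = ψ s) : Function.Surjective φ := by
  intro t
  choose sq hsq using fun N => exists_sub_map_mem_pow ψ g hψ hres N t
  -- `(sq N)` is Cauchy
  have hcauchy : ∀ N, sq N ≡ sq (N + 1) [SMOD ((maximalIdeal S) ^ N • ⊤ : Submodule S S)] := by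
    intro N
    rw [SModEq.sub_mem, smul_eq_mul, Ideal.mul_top]
    refine mem_pow_of_map_mem_pow ψ g hg hψ ?_
    have := Ideal.sub_mem _ (Ideal.pow_le_pow_right (Nat.le_succ N) (hsq (N + 1))) (hsq N)
    rw [map_sub]
    rwa [sub_sub_sub_cancel_left] at this
  let c : AdicCompletion.AdicCauchySequence (maximalIdeal S) S := AdicCompletion.AdicCauchySequence.mk (maximalIdeal S) S sq hcauchy
  refine ⟨AdicCompletion.mk (maximalIdeal S) S c, ?_⟩
  haveI : IsAdicComplete (maximalIdeal (MvPowerSeries (Fin n) K)) (MvPowerSeries (Fin n) K) := by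
    rw [maximalIdeal_mvPowerSeries_eq_span K (Fin n)]; infer_instance
  rw [← sub_eq_zero]
  refine eq_zero_of_forall_mem_pow (maximalIdeal (MvPowerSeries (Fin n) K)) fun N => ?_
  -- `mk c ≡ sq N (mod 𝔪̂^N)`
  have hN : AdicCompletion.mk (maximalIdeal S) S c - algebraMap S (AdicCompletion (maximalIdeal S) S) (sq N) ∈
      maximalIdeal (AdicCompletion (maximalIdeal S) S) ^ N := by
    refine mem_maximalIdeal_pow_of_val_eq_zero ?_
    rw [AdicCompletion.val_sub_apply, AdicCompletion.algebraMap_apply, Algebra.algebraMap_self_apply, AdicCompletion.of_apply,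
      AdicCompletion.mk_apply_coe, Submodule.mkQ_apply, Submodule.mkQ_apply]
    exact sub_self _
  have h1 := extend_sub_mem_pow g hg hψ hφ hN
  have := Ideal.sub_mem _ h1 (hsq N)
  rwa [sub_sub_sub_cancel_right] at this

variable (ψ)

include hg hψ in
/-- **Completion recognition.** Let `S` be a Noetherian local ring, `K` a field, `ψ : S → K⟦X₁,…,Xₙ⟧` a ring homomorphism sending a generating
family `g₁,…,gₙ` of `𝔪_S` to the variables, such that every element of `K` is the constant term of some `ψ s` (the induced residue map is onto).
Then there is a ring ISOMORPHISM `ψ̂ : Ŝ ≃+* K⟦X₁,…,Xₙ⟧` extending `ψ`. [cite: Matsumura1987, Thm. 8.12] [folklore] -/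
theorem exists_ringEquiv (hres : ∀ c : K, ∃ s : S, constantCoeff (ψ s) = c) :
    ∃ e : AdicCompletion (maximalIdeal S) S ≃+* MvPowerSeries (Fin n) K,
      ∀ s : S, e (algebraMap S (AdicCompletion (maximalIdeal S) S) s) = ψ s := by
  haveI : IsAdicComplete (maximalIdeal (MvPowerSeries (Fin n) K)) (MvPowerSeries (Fin n) K) := by
    rw [maximalIdeal_mvPowerSeries_eq_span K (Fin n)]; infer_instance
  obtain ⟨φ, hφ⟩ := Isol.exists_ringHom_adicCompletion_extend (maximalIdeal S) (maximalIdeal (MvPowerSeries (Fin n) K)) ψ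
    (le_of_eq (map_maximalIdeal_eq ψ g hg hψ))
  have hφ' : ∀ s : S, φ (algebraMap S (AdicCompletion (maximalIdeal S) S) s) = ψ s := fun s => by
    rw [AdicCompletion.algebraMap_apply, Algebra.algebraMap_self_apply]; exact hφ s
  exact ⟨RingEquiv.ofBijective φ ⟨extend_injective g hg hψ hφ', extend_surjective g hg hψ hres hφ'⟩, hφ'⟩

end Completion

end Summit.ResolutionOfSingularities.ResolutionOfSingularities.Theorems.SwitchingDichotomy.CompletionRecognition

end
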